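import Literature.ModelTheory.ExponentialFields.KhovanskiiSystems
import Literature.ModelTheory.ExponentialFields.Wilkie1989Khovanskii
import Literature.Analysis.ODE.RolleKhovanskii
import Literature.LinearAlgebra.Matrix.CrossProduct
import HarnessLib

/-!
# Khovanskii's elimination step II: the lifted system defines a regular level curve

Topic `Literature/ModelTheory/ExponentialFields`. Real semantics of the lifted system
`liftH G = (G₁, …, G_N, x_{N+2} · minorSq G - 1)` of `KhovanskiiSystems.lean` at fixed real
parameters `β`: its zero set `Γ_β ⊆ ℝ^{N+2}` is a closed, everywhere **regular** level curve
(the Rabinowitsch equation forces the maximal minors of `∂G/∂x̄` not all to vanish, Wilkie 1989,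
p. 396, (∗)), and together with the cross product of the gradient rows it is a
`Literature.Analysis.ODE.LevelCurveData` (`Khovanskii.curveData`), to which the Rolle–Khovanskii
count of `Literature/Analysis/ODE/RolleKhovanskii.lean` applies. Everything is **proved**:

* semantic lemmas on `liftTerm` / `liftSys` / renamed parameters valid in every lawful structure
  (the tree's versions in `Wilkie1989Lemma3.lean` are stated for models of `T_exp`; here for
  `ℝ` as well): `realize_liftTerm'`, `grad_liftTerm'`, `grad_liftSys_castSucc'`,
  `grad_liftSys_last'`, `realize_relabel_kappa`, `grad_relabel_kappa`;
* `Khovanskii.ndZeros` — the set of non-degenerate zeros `{x : K(a, x) = 0, det ∂K/∂x ≠ 0}` of a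
  square system at real parameters;
* `Khovanskii.jacR`, `Khovanskii.crossR` — the real Jacobian of the lifted system and its cross
  product, `crossR` being the realization of explicit terms (`crossTerm`), hence smooth;
* `Khovanskii.linearIndependent_jacR` — **regularity** of `Γ_β`;
* `Khovanskii.curveData G β : LevelCurveData (N + 1)` — the curve data (`H = liftH G` realized,
  `v = crossR`).

## References

* A. G. Khovanskii, *Fewnomials*, Transl. Math. Monogr. 88, AMS (1991), Ch. III. [Khovanskii1991]
* A. J. Wilkie, *On the theory of the real exponential field*, Illinois J. Math. 33 (1989), §5
  (Proposition, p. 402) and p. 396 (the equation `x_{n+1} · f - 1 = 0`). [Wilkie1989]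
-/

noncomputable section

open FirstOrder FirstOrder.Language FirstOrder.Language.Structure
open Literature.LinearAlgebra.Matrix

namespace Literature.ModelTheory.ExponentialFields

namespace RealExpModel

/-! ### Lifted terms and renamed parameters in a lawful structure -/

section Lawful

variable {M : Type*} [Language.orderedExpRing.Structure M] [Field M] [LinearOrder M]
  [LawfulStructure M] {κ κ' : Type} {n p : ℕ}

omit [Field M] [LinearOrder M] [LawfulStructure M] in
/-- Realization of a lifted term at `(β, y)` (any structure). [folklore] -/
@[simp] theorem realize_liftTerm' (t : Language.orderedExpRing.Term (κ ⊕ Fin n)) (a : κ → M)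
    (β : Fin n → M) (y : M) :
    (liftTerm t).realize (Sum.elim a (Fin.snoc β y : Fin (n + 1) → M)) = t.realize (Sum.elim a β) := by
  rw [liftTerm, Term.realize_relabel]
  congr 1
  funext x
  rcases x with c | j <;> simp

/-- Partial derivatives of a lifted term along the old variables (any lawful structure).
[folklore] -/
@[simp] theorem realize_termPDeriv_castSucc_liftTerm' (t : Language.orderedExpRing.Term (κ ⊕ Fin n))
    (a : κ → M) (β : Fin n → M) (y : M) (j : Fin n) :
    (termPDeriv (Fin.castSucc j) (liftTerm t)).realize (Sum.elim a (Fin.snoc β y : Fin (n + 1) → M)) =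
      (termPDeriv j t).realize (Sum.elim a β) := by
  rw [liftTerm, realize_termPDeriv_relabel_of_injective (Fin.castSucc_injective n)]
  congr 1
  funext x
  rcases x with c | i <;> simp

/-- A lifted term does not depend on the new variable (any lawful structure). [folklore] -/
@[simp] theorem realize_termPDeriv_last_liftTerm' (t : Language.orderedExpRing.Term (κ ⊕ Fin n))
    (a : κ → M) (w : Fin (n + 1) → M) :
    (termPDeriv (Fin.last n) (liftTerm t)).realize (Sum.elim a w) = 0 :=
  realize_termPDeriv_relabel_of_not_mem_range _
    (by rintro ⟨j, hj⟩; exact (Fin.castSucc_lt_last j).ne hj) t _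

/-- Gradient of a lifted term: `(∇t(β), 0)` (any lawful structure). [folklore] -/
theorem grad_liftTerm' (t : Language.orderedExpRing.Term (κ ⊕ Fin n)) (a : κ → M) (β : Fin n → M)
    (y : M) : grad (liftTerm t) a (Fin.snoc β y) = Fin.snoc (grad t a β) 0 := by
  funext j
  refine Fin.lastCases ?_ (fun j => ?_) j
  · simp [grad]
  · simp [grad]

omit [Field M] [LinearOrder M] [LawfulStructure M] in
/-- Values of the lifted system at `(β, y)`. [folklore] -/
theorem realize_liftSys_castSucc' (h : Fin p → Language.orderedExpRing.Term (κ ⊕ Fin n))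
    (fT : Language.orderedExpRing.Term (κ ⊕ Fin n)) (a : κ → M) (β : Fin n → M) (y : M)
    (r : Fin p) :
    (liftSys h fT (Fin.castSucc r)).realize (Sum.elim a (Fin.snoc β y : Fin (n + 1) → M)) =
      (h r).realize (Sum.elim a β) := by
  simp [liftSys]

/-- Value of the Rabinowitsch equation at `(β, y)`: `y · f(β) - 1`. [folklore] -/
theorem realize_liftSys_last' (h : Fin p → Language.orderedExpRing.Term (κ ⊕ Fin n))
    (fT : Language.orderedExpRing.Term (κ ⊕ Fin n)) (a : κ → M) (β : Fin n → M) (y : M) :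
    (liftSys h fT (Fin.last p)).realize (Sum.elim a (Fin.snoc β y : Fin (n + 1) → M)) =
      y * fT.realize (Sum.elim a β) + -1 := by
  simp [liftSys]

/-- Gradient of `hₚ₊₁ = xₙ₊₁ · f - 1` at `(β, y)`: `(y ∇f(β), f(β))` (any lawful structure).
[folklore] -/
theorem grad_liftSys_last' (h : Fin p → Language.orderedExpRing.Term (κ ⊕ Fin n))
    (fT : Language.orderedExpRing.Term (κ ⊕ Fin n)) (a : κ → M) (β : Fin n → M) (y : M) :
    grad (liftSys h fT (Fin.last p)) a (Fin.snoc β y) =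
      Fin.snoc (y • grad fT a β) (fT.realize (Sum.elim a β)) := by
  funext j
  refine Fin.lastCases ?_ (fun j => ?_) j
  · simp [grad, liftSys, termPDeriv]
  · have hne : Fin.last n ≠ j.castSucc := (Fin.castSucc_lt_last j).ne'
    simp [grad, liftSys, termPDeriv, hne]

/-- Gradient of the lifted `hᵣ` at `(β, y)`: `(∇hᵣ(β), 0)` (any lawful structure). [folklore] -/
theorem grad_liftSys_castSucc' (h : Fin p → Language.orderedExpRing.Term (κ ⊕ Fin n))
    (fT : Language.orderedExpRing.Term (κ ⊕ Fin n)) (a : κ → M) (β : Fin n → M) (y : M)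
    (r : Fin p) :
    grad (liftSys h fT (Fin.castSucc r)) a (Fin.snoc β y) = Fin.snoc (grad (h r) a β) 0 := by
  simp [liftSys, grad_liftTerm']

/-- Renaming parameters commutes with formal partial derivatives (any lawful structure).
[folklore] -/
theorem realize_termPDeriv_relabel_params' (g : κ → κ') (j : Fin n)
    (t : Language.orderedExpRing.Term (κ ⊕ Fin n)) (v : κ' ⊕ Fin n → M) :
    (termPDeriv j (t.relabel (Sum.map g _root_.id))).realize v =
      (termPDeriv j t).realize (v ∘ Sum.map g _root_.id) := by
  induction t with
  | var x =>
    rcases x with c | i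
    · simp [Term.relabel, termPDeriv]
    · by_cases hij : i = j
      · subst hij; simp [Term.relabel, termPDeriv]
      · simp [Term.relabel, termPDeriv, hij]
  | func g ts ih =>
    cases g with
    | add => simp [Term.relabel, termPDeriv, ih]
    | mul => simp [Term.relabel, termPDeriv, ih, Term.realize_relabel]
    | neg => simp [Term.relabel, termPDeriv, ih]
    | zero => simp [Term.relabel, termPDeriv]
    | one => simp [Term.relabel, termPDeriv]
    | exp =>
      simp [Term.relabel, termPDeriv, ih, Term.realize_relabel, ExpTerm.realize_termExp_eq_funMap]

end Lawful

end RealExpModel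

namespace Khovanskii

open ExpTerm RealExpModel

variable {m N : ℕ}

/-! ### Renamed parameters `kappa` -/

/-- The valuation `((β, δ), z)` read through `kappa` is `(β, z)`. [folklore] -/
theorem sumElim_snoc_comp_kappa (β : Fin m → ℝ) (δ : ℝ) (z : Fin (N + 2) → ℝ) :
    Sum.elim (Fin.snoc β δ : Fin (m + 1) → ℝ) z ∘ kappa m N = Sum.elim β z := by
  funext x
  rcases x with c | j <;> simp [kappa]

/-- A term with renamed parameters has the same value. [folklore] -/
@[simp] theorem realize_relabel_kappa (t : Language.orderedExpRing.Term (Fin m ⊕ Fin (N + 2)))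
    (β : Fin m → ℝ) (δ : ℝ) (z : Fin (N + 2) → ℝ) :
    (t.relabel (kappa m N)).realize (Sum.elim (Fin.snoc β δ : Fin (m + 1) → ℝ) z) =
      t.realize (Sum.elim β z) := by
  rw [Term.realize_relabel, sumElim_snoc_comp_kappa]

/-- A term with renamed parameters has the same gradient. [folklore] -/
@[simp] theorem grad_relabel_kappa (t : Language.orderedExpRing.Term (Fin m ⊕ Fin (N + 2)))
    (β : Fin m → ℝ) (δ : ℝ) (z : Fin (N + 2) → ℝ) :
    grad (t.relabel (kappa m N)) (Fin.snoc β δ : Fin (m + 1) → ℝ) z = grad t β z := by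
  funext j
  have h := sumElim_snoc_comp_kappa β δ z
  rw [kappa] at h
  rw [grad_apply, grad_apply, kappa, realize_termPDeriv_relabel_params', h]

/-- The new parameter `pVar` has value `δ`. [folklore] -/
@[simp] theorem realize_pVar (β : Fin m → ℝ) (δ : ℝ) (z : Fin (N + 2) → ℝ) :
    (pVar m N).realize (Sum.elim (Fin.snoc β δ : Fin (m + 1) → ℝ) z) = δ := by
  simp [pVar]

/-- The new parameter has vanishing gradient in the unknowns. [folklore] -/
@[simp] theorem grad_pVar (β : Fin m → ℝ) (δ : ℝ) (z : Fin (N + 2) → ℝ) :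
    grad (pVar m N) (Fin.snoc β δ : Fin (m + 1) → ℝ) z = 0 := by
  funext j
  simp [grad, pVar]

/-! ### Non-degenerate zeros of a square system -/

/-- The set of **non-degenerate zeros** at real parameters `a` of a square system `K` of terms:
common zeros at which the Jacobian determinant does not vanish (`= realNonsingularZeroSet`,
`ndZeros_eq_realNonsingularZeroSet`). [cite: Wilkie1989, §5, Proposition, p. 402] -/
def ndZeros {κ : Type} {n : ℕ} (K : Fin n → Language.orderedExpRing.Term (κ ⊕ Fin n))
    (a : κ → ℝ) : Set (Fin n → ℝ) :=
  {x | (∀ i, (K i).realize (Sum.elim a x) = 0) ∧ (Matrix.of fun i => grad (K i) a x).det ≠ 0}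

/-- Membership in `ndZeros`. [folklore] -/
theorem mem_ndZeros {κ : Type} {n : ℕ} {K : Fin n → Language.orderedExpRing.Term (κ ⊕ Fin n)}
    {a : κ → ℝ} {x : Fin n → ℝ} :
    x ∈ ndZeros K a ↔
      (∀ i, (K i).realize (Sum.elim a x) = 0) ∧ (Matrix.of fun i => grad (K i) a x).det ≠ 0 :=
  Iff.rfl

/-- `ndZeros` is the real non-singular zero set of the square system. [folklore] -/
theorem ndZeros_eq_realNonsingularZeroSet {m n : ℕ}
    (K : Fin n → Language.orderedExpRing.Term (Fin m ⊕ Fin n)) (a : Fin m → ℝ) :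
    ndZeros K a = realNonsingularZeroSet K a := by
  ext x
  rw [mem_ndZeros, mem_realNonsingularZeroSet, linearIndependent_rows_iff_det_ne_zero]
  rfl

/-! ### The real Jacobian of the lifted system and its cross product -/

variable (G : Fin N → Language.orderedExpRing.Term (Fin m ⊕ Fin (N + 1))) (β : Fin m → ℝ)

/-- The real Jacobian of the lifted system at `z`. [folklore] -/
def jacR (z : Fin (N + 2) → ℝ) : Matrix (Fin (N + 1)) (Fin (N + 2)) ℝ :=
  Matrix.of fun r => grad (liftH G r) β z

/-- Rows of `jacR`. [folklore] -/
theorem jacR_apply (z : Fin (N + 2) → ℝ) (r : Fin (N + 1)) : jacR G β z r = grad (liftH G r) β z :=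
  rfl

/-- The signed maximal minors of the Jacobian of terms of the lifted system, as terms. [folklore] -/
def crossTerm (c : Fin (N + 2)) : Language.orderedExpRing.Term (Fin m ⊕ Fin (N + 2)) :=
  ExpTerm.sign (N + 1 + (c : ℕ)) * ExpTerm.det ((jacH G).submatrix _root_.id c.succAbove)

/-- The **tangent field**: the cross product of the gradient rows of the lifted system.
[folklore] -/
def crossR (z : Fin (N + 2) → ℝ) : Fin (N + 2) → ℝ := cross (jacR G β z)

/-- The cross product is the realization of `crossTerm`. [folklore] -/
theorem crossR_apply (z : Fin (N + 2) → ℝ) (c : Fin (N + 2)) :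
    crossR G β z c = (crossTerm G c).realize (Sum.elim β z) := by
  rw [crossR, cross_def, crossTerm, ExpTerm.realize_mul, ExpTerm.realize_sign, ExpTerm.realize_det]
  rfl

/-- The tangent field is smooth. [folklore] -/
theorem contDiff_crossR {n : WithTop ℕ∞} : ContDiff ℝ n (crossR G β) := by
  rw [contDiff_pi]
  intro c
  have := contDiff_realize (crossTerm G c) β (n := n)
  convert this using 1
  funext z
  exact crossR_apply G β z c

/-- `dH(v) = 0`: the Jacobian annihilates the cross product of its rows. [folklore] -/
theorem fderiv_sysFun_crossR (z : Fin (N + 2) → ℝ) :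
    fderiv ℝ (sysFun (liftH G) β) z (crossR G β z) = 0 := by
  rw [fderiv_sysFun_apply, crossR]
  exact mulVec_cross (jacR G β z)

/-! ### Regularity of the lifted zero set -/

/-- The real Jacobian of the stage-1 system at `w ∈ ℝ^{N+1}`. [folklore] -/
def jacW (w : Fin (N + 1) → ℝ) : Matrix (Fin N) (Fin (N + 1)) ℝ := Matrix.of fun r => grad (G r) β w

/-- `minorSq G` realizes to the sum of the squares of the entries of `cross (jacW)`. [folklore] -/
theorem realize_minorSq (w : Fin (N + 1) → ℝ) :
    (minorSq G).realize (Sum.elim β w) = ∑ c, cross (jacW G β w) c ^ 2 := by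
  rw [minorSq, ExpTerm.realize_sum]
  refine Finset.sum_congr rfl fun c _ => ?_
  have hm : (minorT G c).realize (Sum.elim β w) = ((jacW G β w).submatrix _root_.id c.succAbove).det := by
    rw [minorT, ExpTerm.realize_det]
    rfl
  rw [ExpTerm.realize_mul, hm, cross_def, mul_pow, ← pow_mul, Even.neg_one_pow ⟨N + (c : ℕ), by ring⟩,
    one_mul, pow_two]

/-- At a point of the lifted zero set, the cross product of the stage-1 Jacobian is nonzero.
[folklore] -/
theorem cross_jacW_ne_zero {z : Fin (N + 2) → ℝ} (hz : sysFun (liftH G) β z = 0) :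
    cross (jacW G β (Fin.init z)) ≠ 0 := by
  intro hzero
  have hlast := congrFun hz (Fin.last N)
  rw [Pi.zero_apply, sysFun, liftH, ← Fin.snoc_init_self z, realize_liftSys_last',
    realize_minorSq, hzero] at hlast
  simp at hlast

/-- `minorSq G ≠ 0` at points of the lifted zero set. [folklore] -/
theorem realize_minorSq_ne_zero {z : Fin (N + 2) → ℝ} (hz : sysFun (liftH G) β z = 0) :
    (minorSq G).realize (Sum.elim β (Fin.init z)) ≠ 0 := by
  intro hzero
  have hlast := congrFun hz (Fin.last N)
  rw [Pi.zero_apply, sysFun, liftH, ← Fin.snoc_init_self z, realize_liftSys_last', hzero] at hlast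
  simp at hlast

/-- The linear map `v ↦ (v, 0)` on `ℝⁿ`. [folklore] -/
def snocZeroR (n : ℕ) : (Fin n → ℝ) →ₗ[ℝ] (Fin (n + 1) → ℝ) where
  toFun v := Fin.snoc v 0
  map_add' v w := by
    funext j; refine Fin.lastCases ?_ (fun j => ?_) j <;> simp
  map_smul' c v := by
    funext j; refine Fin.lastCases ?_ (fun j => ?_) j <;> simp

/-- `v ↦ (v, 0)` is injective. [folklore] -/
theorem snocZeroR_injective (n : ℕ) : Function.Injective (snocZeroR n) := by
  intro v w hvw
  funext j
  have := congrFun hvw (Fin.castSucc j)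
  simpa [snocZeroR] using this

/-- Rows `(∇hᵣ, 0)` and `(y ∇f, f)` with `∇hᵣ` independent and `f ≠ 0` are independent
(real version of Wilkie's (∗), p. 396). [cite: Wilkie1989, proof of Lemma 3, pp. 396–397] -/
theorem linearIndependent_grad_liftSys_real {κ : Type} {n p : ℕ}
    {h : Fin p → Language.orderedExpRing.Term (κ ⊕ Fin n)} {fT : Language.orderedExpRing.Term (κ ⊕ Fin n)}
    {a : κ → ℝ} {w : Fin n → ℝ} {y : ℝ}
    (hind : LinearIndependent ℝ (fun r => grad (h r) a w)) (hf : fT.realize (Sum.elim a w) ≠ 0) :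
    LinearIndependent ℝ (fun r => grad (liftSys h fT r) a (Fin.snoc w y)) := by
  have e : (fun r => grad (liftSys h fT r) a (Fin.snoc w y)) =
      Fin.snoc (fun r => Fin.snoc (grad (h r) a w) (0 : ℝ))
        (Fin.snoc (y • grad fT a w) (fT.realize (Sum.elim a w))) := by
    funext r
    refine Fin.lastCases ?_ (fun r => ?_) r
    · simp [grad_liftSys_last']
    · simp [grad_liftSys_castSucc']
  rw [e, linearIndependent_finSnoc]
  constructor
  · exact hind.map' (snocZeroR n) (LinearMap.ker_eq_bot.2 (snocZeroR_injective n))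
  · intro hmem
    have hlast : ∀ v ∈ Submodule.span ℝ (Set.range fun r => (Fin.snoc (grad (h r) a w) (0 : ℝ) :
        Fin (n + 1) → ℝ)), v (Fin.last n) = 0 := by
      intro v hv
      refine Submodule.span_induction (p := fun v _ => v (Fin.last n) = 0) ?_ ?_ ?_ ?_ hv
      · rintro _ ⟨r, rfl⟩; simp
      · simp
      · intro v v' _ _ hv hv'; simp [hv, hv']
      · intro c v _ hv; simp [hv]
    have := hlast _ hmem
    simp at this
    exact hf this

/-- **Regularity of the lifted zero set**: at every real zero of `liftH G` the gradient rows are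
linearly independent. [cite: Wilkie1989, proof of Lemma 3, pp. 396–397] -/
theorem linearIndependent_jacR {z : Fin (N + 2) → ℝ} (hz : sysFun (liftH G) β z = 0) :
    LinearIndependent ℝ (fun r => jacR G β z r) := by
  have hrows : LinearIndependent ℝ (fun r => grad (G r) β (Fin.init z)) :=
    linearIndependent_rows_of_cross_ne_zero (jacW G β (Fin.init z)) (cross_jacW_ne_zero G β hz)
  have h := linearIndependent_grad_liftSys_real (y := z (Fin.last (N + 1))) hrows
    (realize_minorSq_ne_zero G β hz)
  rw [Fin.snoc_init_self] at h
  exact h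

/-- Hence the tangent field does not vanish on the lifted zero set. [folklore] -/
theorem crossR_ne_zero {z : Fin (N + 2) → ℝ} (hz : sysFun (liftH G) β z = 0) : crossR G β z ≠ 0 :=
  cross_ne_zero_of_linearIndependent_rows _ (linearIndependent_jacR G β hz)

/-- **The curve data of the lifted system** at parameters `β`: `H = liftH G` (realized), tangent
field the cross product of its gradient rows. [cite: Khovanskii1991, Ch. III] -/
def curveData : Literature.Analysis.ODE.LevelCurveData (N + 1) where
  H := sysFun (liftH G) β
  v := crossR G β
  contDiff_H := contDiff_sysFun (liftH G) β
  contDiff_v := contDiff_crossR G β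
  fderiv_H_v := fderiv_sysFun_crossR G β
  v_ne_zero := fun _ hz => crossR_ne_zero G β hz
  surjective_fderiv := fun z hz =>
    LinearMap.range_eq_top.1 (range_fderiv_sysFun_eq_top (liftH G) β z (linearIndependent_jacR G β hz))

/-- The curve of `curveData` is the real zero set of the lifted system. [folklore] -/
theorem mem_curve_curveData {z : Fin (N + 2) → ℝ} :
    z ∈ (curveData G β).curve ↔ sysFun (liftH G) β z = 0 := Iff.rfl

end Khovanskii

end Literature.ModelTheory.ExponentialFields
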